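import Literature.Topology.FourManifolds.TrisectionsMiddleCharts
import HarnessLib

/-!
# The handlebodies `H₁₂ = X₁ ∩ X₂` and `H₃₁ = X₃ ∩ X₁` of the trisection from a handle
# decomposition (Gay–Kirby 2016, Lemma 14 — clause (iii) of a trisection, first part)

Topic `Literature/Topology/FourManifolds`; infrastructure for the fact seat
`provefact-Literature.Topology.FourManifolds.exists_isBalancedGKTrisection` (Gay–Kirby 2016,
Thm. 4 via Lemma 14).  Everything in this file is **proved**; no named facts are introduced.

Gay–Kirby, proof of Lemma 14: *"Consider the Heegaard splitting `F ⊂ ∂X₁`, giving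
`∂X₁ = H₁₂ ∪_F H₃₁` … Then `X₂ ∩ X₁ = H₁₂`"*.  With the bevelled first sector `X₁` of
`TrisectionsBevelledSector.lean` (`X₁ = {s + κ θ ≤ 0}`, `θ = χ₁(s) χ₂(r)|r|`) the intersection
`X₁ ∩ X₂` is the **graph of the bevel** over the half `{g ≤ b}` of the level `∂X₁⁰ = f⁻¹(a)`:
`X₁ ∩ X₂ = {F₁ = 0, r ≤ 0} = {U.fl y (κ χ₂(r) r) : y ∈ ∂X₁⁰, r = g y - b ≤ 0}`
(`range_graphMap₁₂`).  This file realises it as the image of the compact `3`-manifold with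
boundary `{g ≤ b} ⊆ ∂X₁⁰` (`Literature.RegularSublevel B.hg`, `RegularLevelSplitting.lean`) under
the graph map of the height `τ = κ χ₂(r) r` (`BiCollar.graphMap`, for a general `Height` over a
general regular domain of the level) — `f = a + τ`, `r = g - b`, `F₁ = 0` along it —
whose boundary `{g = b}` goes onto the central surface `F = X₁ ∩ X₂ ∩ X₃`
(`image_boundary_graphMap₁₂`, `iInter_eq_surface`), and symmetrically `X₃ ∩ X₁` as the image
of `{g ≥ b}` (`Literature.RegularSuperlevel B.hg`) under the graph of `-τ`.  The graph maps are
**smooth embeddings** (`isSmoothEmbedding_graphMap`: closed topological embeddings, and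
immersions — in the half-slice chart of the domain at a point and the chart of `X` obtained by
shearing the product chart of the level along the flow by the height, `grChart`, the map reads
`u ↦ (u, 0)`).  The handle decompositions, connectedness and compactness of these `3`-manifolds
are those of the regular sub/superlevel sets of the Heegaard function `g`
(`RegularSublevel.hasHandleDecomposition`, `.connectedSpace`, `.connectedSpace_superlevel`), whence
**clause (iii) of `IsGKTrisection` for the pairs `(X₁, X₂)` and `(X₃, X₁)`** in terms of the
Morse data of `g` (`TriData.exists_H₁₂`, `TriData.exists_H₃₁`).

## References

* D. Gay, R. Kirby, *Trisecting 4-manifolds*, Geom. Topol. 20 (2016) 3097–3132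
  (arXiv:1205.1565): Def. 1; §4, Lemma 14 and its proof. [GayKirby2016]
* J. Milnor, *Morse theory* (1963), Thm. 3.1 (regular sublevel sets). [Milnor1963]
-/

open scoped Manifold ContDiff Topology
open Set Function Filter

noncomputable section

universe u

namespace Literature.Topology.FourManifolds

variable {X : Type u} [TopologicalSpace X] [T2Space X] [CompactSpace X]
  [ChartedSpace (EuclideanSpace ℝ (Fin 4)) X] [IsManifold (𝓡 4) ∞ X]

namespace BiCollar

variable {B : BiCollar X}

/-! ### Heights over the level and their graphs -/

variable (B) in
/-- A **bevel height**: a smooth function on the level `∂X₁⁰` with values in `(-δ_U, δ_U)` (the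
height of a sheet of `∂X₁` over the level, measured along the flow of `U`).
[cite: GayKirby2016, §4, Lemma 14] -/
structure Height where
  /-- The function. -/
  toFun : B.Y → ℝ
  /-- It is smooth. -/
  contMDiff : ContMDiff (𝓡 3) 𝓘(ℝ, ℝ) ∞ toFun
  /-- It stays inside the band of `U`. -/
  abs_lt : ∀ y, |toFun y| < B.U.δ

namespace Height

/-- A height is used as a function on the level. [folklore] -/
instance : CoeFun (Height B) fun _ => B.Y → ℝ := ⟨Height.toFun⟩

variable (η : Height B)

omit [T2Space X] [CompactSpace X] in
/-- A height is continuous. [folklore] -/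
protected theorem continuous : Continuous η := η.contMDiff.continuous

omit [T2Space X] [CompactSpace X] in
/-- `η y ∈ (-δ_U, δ_U)`. [folklore] -/
theorem mem_Ioo (y : B.Y) : η y ∈ Ioo (-B.U.δ) B.U.δ := _root_.abs_lt.1 (η.abs_lt y)

/-- The negative height. [folklore] -/
def neg : Height B where
  toFun y := -η y
  contMDiff := η.contMDiff.neg
  abs_lt y := by rw [abs_neg]; exact η.abs_lt y

omit [T2Space X] [CompactSpace X] in
/-- The negative height, evaluated. [folklore] -/
@[simp] theorem neg_apply (y : B.Y) : η.neg y = -η y := rfl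

end Height

/-! ### The graph map of a height over a regular domain of the level -/

section Graph

variable (η : Height B) {f' : B.Y → ℝ} {a' : ℝ} (h' : IsRegularLevel (𝓡 3) f' a')

/-- **The graph map** of the height `η` over the regular domain `{f' ≤ a'}` of the level:
`y ↦ U.fl y (η y)`. [cite: GayKirby2016, §4, Lemma 14] -/
def graphMap (p : RegularSublevel h') : X :=
  B.U.fl (RegularLevel.incl B.hf (RegularSublevel.incl h' p)) (η (RegularSublevel.incl h' p))

/-- The graph map is continuous. [folklore] -/
theorem continuous_graphMap : Continuous (graphMap η h') :=
  B.U.continuous_fl.comp (((RegularLevel.isEmbedding_incl B.hf).continuous.comp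
    (RegularSublevel.continuous_incl h')).prodMk (η.continuous.comp (RegularSublevel.continuous_incl h')))

/-- Along the graph, `f = a + η`. [cite: MilnorHCobordism1965, proof of Thm. 3.4] -/
theorem f_graphMap (p : RegularSublevel h') : B.f (graphMap η h' p) = B.a + η (RegularSublevel.incl h' p) :=
  B.U.apply_fl_of_apply_eq (RegularLevel.apply_incl B.hf _) (η.mem_Ioo _)

/-- Along the graph, `s = η`. [folklore] -/
theorem sFun_graphMap (p : RegularSublevel h') : B.sFun (graphMap η h' p) = η (RegularSublevel.incl h' p) := by
  rw [BiCollar.sFun, f_graphMap]; ring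

/-- The graph lies in the band of `U`. [folklore] -/
theorem graphMap_mem_band (p : RegularSublevel h') : graphMap η h' p ∈ B.U.band :=
  B.mem_band_U (by rw [sFun_graphMap]; exact η.abs_lt _)

/-- Along the graph, the drop onto the level is the base point. [folklore] -/
theorem yL_graphMap (p : RegularSublevel h') : B.yL (graphMap η h' p) = RegularSublevel.incl h' p :=
  B.yL_fl _ (η.mem_Ioo _)

/-- Along the graph, `r = g - b`. [folklore] -/
theorem rFun_graphMap (p : RegularSublevel h') : B.rFun (graphMap η h' p) = B.g (RegularSublevel.incl h' p) - B.b := by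
  rw [BiCollar.rFun, yL_graphMap]

/-- The graph map is injective (the base point is the drop of the image). [folklore] -/
theorem injective_graphMap : Injective (graphMap η h') := fun p q h => by
  apply RegularSublevel.injective_incl h'
  rw [← yL_graphMap η h' p, ← yL_graphMap η h' q, h]

/-- **The graph map is a closed topological embedding** (continuous and injective on a compact
space into a Hausdorff space). [folklore] -/
theorem isClosedEmbedding_graphMap : Topology.IsClosedEmbedding (graphMap η h') :=
  (continuous_graphMap η h').isClosedEmbedding (injective_graphMap η h')

/-- A point of the band whose `s`-coordinate is the height of its drop is on the graph.
[folklore] -/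
theorem mem_range_graphMap_of_eq {x : X} (hxU : x ∈ B.U.band) (hle : f' (B.yL x) ≤ a')
    (hs : B.sFun x = η (B.yL x)) : x ∈ range (graphMap η h') := by
  refine ⟨RegularSublevel.mk h' (B.yL x) hle, ?_⟩
  show B.U.fl (RegularLevel.incl B.hf (B.yL x)) (η (B.yL x)) = x
  rw [← hs, B.incl_yL hxU, BiCollar.sFun]
  exact B.U.fl_drop x

/-- The graph over the boundary `{f' = a'}` of the domain, where the height vanishes, lies on
the level. [folklore] -/
theorem graphMap_eq_of_apply_eq {p : RegularSublevel h'} (h0 : η (RegularSublevel.incl h' p) = 0) :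
    graphMap η h' p = RegularLevel.incl B.hf (RegularSublevel.incl h' p) := by
  rw [graphMap, h0, B.U.fl_zero]

end Graph

/-! ### The graph map is a smooth embedding: adapted charts of `X` -/

/-- The first three coordinates of a vector of `ℝ⁴`, as a vector of `ℝ³`. [folklore] -/
def head3 (w : EuclideanSpace ℝ (Fin 4)) : EuclideanSpace ℝ (Fin 3) := !₂[w 0, w 1, w 2]

omit [T2Space X] [CompactSpace X] [ChartedSpace (EuclideanSpace ℝ (Fin 4)) X] [IsManifold (𝓡 4) ∞ X] in
/-- `head3` is smooth. [folklore] -/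
theorem _root_.Literature.Topology.FourManifolds.BiCollar.contDiff_head3 : ContDiff ℝ ∞ (head3 : EuclideanSpace ℝ (Fin 4) → _) := by
  have hc : ∀ i : Fin 4, ContDiff ℝ ∞ fun w : EuclideanSpace ℝ (Fin 4) => w i :=
    fun i => contDiff_euclidean.mp contDiff_id i
  have h : ContDiff ℝ ∞ fun w : EuclideanSpace ℝ (Fin 4) => ![w 0, w 1, w 2] := by
    rw [contDiff_pi]
    intro i
    fin_cases i
    · exact hc 0
    · exact hc 1
    · exact hc 2
  exact (PiLp.contDiff_toLp (p := 2)).comp h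

/-- **The linear isomorphism `ℝ³ × ℝ ≅ ℝ⁴`**, `(v, t) ↦ (v₀, v₁, v₂, t)` (the complement datum of
the immersion). [folklore] -/
def appendLin : (EuclideanSpace ℝ (Fin 3) × ℝ) ≃ₗ[ℝ] EuclideanSpace ℝ (Fin 4) where
  toFun p := !₂[p.1 0, p.1 1, p.1 2, p.2]
  invFun w := (head3 w, w 3)
  map_add' p q := by
    ext i
    fin_cases i <;> simp
  map_smul' c p := by
    ext i
    fin_cases i <;> simp
  left_inv p := by
    obtain ⟨v, t⟩ := p
    refine Prod.ext ?_ rfl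
    ext i
    fin_cases i <;> rfl
  right_inv w := by
    ext i
    fin_cases i <;> rfl

/-- The linear isomorphism `ℝ³ × ℝ ≅ ℝ⁴`, continuous. [folklore] -/
def appendEquiv : (EuclideanSpace ℝ (Fin 3) × ℝ) ≃L[ℝ] EuclideanSpace ℝ (Fin 4) :=
  appendLin.toContinuousLinearEquiv

omit [T2Space X] [CompactSpace X] [ChartedSpace (EuclideanSpace ℝ (Fin 4)) X] [IsManifold (𝓡 4) ∞ X] in
/-- The linear isomorphism, evaluated (definitional). [folklore] -/
theorem _root_.Literature.Topology.FourManifolds.BiCollar.appendEquiv_apply (v : EuclideanSpace ℝ (Fin 3)) (t : ℝ) :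
    appendEquiv (v, t) = !₂[v 0, v 1, v 2, t] := rfl

section GraphChart

variable (η : Height B) (Θ : OpenPartialHomeomorph B.Y (EuclideanSpace ℝ (Fin 3)))

/-- **The adapted chart as a function**: `x ↦ (Θ (yL x), s x - τ (yL x))` — the product chart
of the level sheared along the flow by the height of the bevel, so that the graph of the bevel
becomes the slice `{w₃ = 0}`. [cite: GayKirby2016, §4, Lemma 14] -/
def grFun (x : X) : EuclideanSpace ℝ (Fin 4) :=
  !₂[Θ (B.yL x) 0, Θ (B.yL x) 1, Θ (B.yL x) 2, B.sFun x - η (B.yL x)]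

/-- The inverse of the adapted chart: `w ↦ U.fl (Θ⁻¹ (w₀, w₁, w₂)) (w₃ + τ (Θ⁻¹ (w₀, w₁, w₂)))`.
[cite: GayKirby2016, §4, Lemma 14] -/
def grInv (w : EuclideanSpace ℝ (Fin 4)) : X :=
  B.U.fl (RegularLevel.incl B.hf (Θ.symm (head3 w))) (w 3 + η (Θ.symm (head3 w)))

/-- The source of the adapted chart: the band of `U` over the source of `Θ`. [folklore] -/
def grSource : Set X := B.U.band ∩ B.yL ⁻¹' Θ.source

/-- The target of the adapted chart. [folklore] -/
def grTarget : Set (EuclideanSpace ℝ (Fin 4)) :=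
  head3 ⁻¹' Θ.target ∩ {w | w 3 + η (Θ.symm (head3 w)) ∈ Ioo (-B.U.δ) B.U.δ}

variable {Θ}

omit [T2Space X] [CompactSpace X] [ChartedSpace (EuclideanSpace ℝ (Fin 4)) X] [IsManifold (𝓡 4) ∞ X] in
/-- `head3 (v₀, v₁, v₂, t) = v`. [folklore] -/
theorem _root_.Literature.Topology.FourManifolds.BiCollar.head3_mk (v : EuclideanSpace ℝ (Fin 3)) (t : ℝ) :
    head3 (!₂[v 0, v 1, v 2, t]) = v := by
  ext i
  fin_cases i <;> rfl

/-- `head3 (grFun x) = Θ (yL x)`. [folklore] -/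
theorem head3_grFun (x : X) : head3 (grFun η Θ x) = Θ (B.yL x) := head3_mk _ _

/-- The last coordinate of `grFun x` is `s x - τ (yL x)`. [folklore] -/
theorem grFun_apply_three (x : X) : grFun η Θ x 3 = B.sFun x - η (B.yL x) := rfl

/-- The adapted chart maps its source into its target. [folklore] -/
theorem grFun_mem_target {x : X} (hx : x ∈ grSource Θ) : grFun η Θ x ∈ grTarget η Θ := by
  refine ⟨?_, ?_⟩
  · show head3 (grFun η Θ x) ∈ Θ.target
    rw [head3_grFun η]
    exact Θ.map_source hx.2
  · show grFun η Θ x 3 + η (Θ.symm (head3 (grFun η Θ x))) ∈ Ioo (-B.U.δ) B.U.δ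
    rw [head3_grFun η, Θ.left_inv hx.2, grFun_apply_three η, sub_add_cancel]
    exact abs_lt.1 ((B.abs_sFun_lt_iff x).2 hx.1)

/-- The inverse maps the target into the source. [folklore] -/
theorem grInv_mem_source {w : EuclideanSpace ℝ (Fin 4)} (hw : w ∈ grTarget η Θ) : grInv η Θ w ∈ grSource Θ := by
  refine ⟨B.U.fl_mem_band (RegularLevel.apply_incl B.hf _) hw.2, ?_⟩
  show B.yL (grInv η Θ w) ∈ Θ.source
  rw [grInv, B.yL_fl _ hw.2]
  exact Θ.map_target hw.1

/-- `grInv ∘ grFun = id` on the source. [folklore] -/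
theorem grInv_grFun {x : X} (hx : x ∈ grSource Θ) : grInv η Θ (grFun η Θ x) = x := by
  rw [grInv, head3_grFun η, Θ.left_inv hx.2, grFun_apply_three η, sub_add_cancel, B.incl_yL hx.1, BiCollar.sFun]
  exact B.U.fl_drop x

/-- `s (grInv w) = w₃ + τ (Θ⁻¹ (head w))`. [folklore] -/
theorem sFun_grInv {w : EuclideanSpace ℝ (Fin 4)} (hw : w ∈ grTarget η Θ) :
    B.sFun (grInv η Θ w) = w 3 + η (Θ.symm (head3 w)) := by
  rw [BiCollar.sFun, grInv, B.U.apply_fl_of_apply_eq (RegularLevel.apply_incl B.hf _) hw.2]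
  ring

/-- `yL (grInv w) = Θ⁻¹ (head w)`. [folklore] -/
theorem yL_grInv {w : EuclideanSpace ℝ (Fin 4)} (hw : w ∈ grTarget η Θ) :
    B.yL (grInv η Θ w) = Θ.symm (head3 w) := by
  rw [grInv, B.yL_fl _ hw.2]

/-- `grFun ∘ grInv = id` on the target. [folklore] -/
theorem grFun_grInv {w : EuclideanSpace ℝ (Fin 4)} (hw : w ∈ grTarget η Θ) : grFun η Θ (grInv η Θ w) = w := by
  have h3 : head3 (grFun η Θ (grInv η Θ w)) = head3 w := by
    rw [head3_grFun η, yL_grInv η hw, Θ.right_inv hw.1]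
  have h4 : grFun η Θ (grInv η Θ w) 3 = w 3 := by
    rw [grFun_apply_three η, sFun_grInv η hw, yL_grInv η hw]; ring
  ext i
  fin_cases i
  · exact congrArg (fun v : EuclideanSpace ℝ (Fin 3) => v 0) h3
  · exact congrArg (fun v : EuclideanSpace ℝ (Fin 3) => v 1) h3
  · exact congrArg (fun v : EuclideanSpace ℝ (Fin 3) => v 2) h3
  · exact h4

/-- **The adapted chart is smooth on its source** (for `Θ` smooth on its source). [folklore] -/
theorem contMDiffOn_grFun (hΘ : ContMDiffOn (𝓡 3) 𝓘(ℝ, EuclideanSpace ℝ (Fin 3)) ∞ Θ Θ.source) :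
    ContMDiffOn (𝓡 4) 𝓘(ℝ, EuclideanSpace ℝ (Fin 4)) ∞ (grFun η Θ) (grSource Θ) := by
  have hyL : ContMDiffOn (𝓡 4) (𝓡 3) ∞ B.yL (grSource Θ) := B.contMDiffOn_yL.mono inter_subset_left
  have hΘy : ContMDiffOn (𝓡 4) 𝓘(ℝ, EuclideanSpace ℝ (Fin 3)) ∞ (fun x => Θ (B.yL x)) (grSource Θ) :=
    hΘ.comp hyL fun x hx => hx.2
  have hc3 : ∀ i : Fin 3, ContDiff ℝ ∞ fun w : EuclideanSpace ℝ (Fin 3) => w i :=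
    fun i => contDiff_euclidean.mp contDiff_id i
  have hΘi : ∀ i : Fin 3, ContMDiffOn (𝓡 4) 𝓘(ℝ, ℝ) ∞ (fun x => Θ (B.yL x) i) (grSource Θ) :=
    fun i x hx => (hc3 i).comp_contMDiffWithinAt (hΘy x hx)
  have hτ : ContMDiffOn (𝓡 4) 𝓘(ℝ, ℝ) ∞ (fun x => B.sFun x - η (B.yL x)) (grSource Θ) :=
    B.contMDiff_sFun.contMDiffOn.sub (η.contMDiff.comp_contMDiffOn hyL)
  have h : ContMDiffOn (𝓡 4) 𝓘(ℝ, Fin 4 → ℝ) ∞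
      (fun x => ![Θ (B.yL x) 0, Θ (B.yL x) 1, Θ (B.yL x) 2, B.sFun x - η (B.yL x)]) (grSource Θ) := by
    rw [contMDiffOn_pi_space]
    intro i
    fin_cases i
    · exact hΘi 0
    · exact hΘi 1
    · exact hΘi 2
    · exact hτ
  exact fun x hx => (PiLp.contDiff_toLp (p := 2)).comp_contMDiffWithinAt (h x hx)

/-- **The inverse of the adapted chart is smooth on the target** (for `Θ⁻¹` smooth on the target). [folklore] -/
theorem contMDiffOn_grInv (hΘ' : ContMDiffOn 𝓘(ℝ, EuclideanSpace ℝ (Fin 3)) (𝓡 3) ∞ Θ.symm Θ.target) :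
    ContMDiffOn 𝓘(ℝ, EuclideanSpace ℝ (Fin 4)) (𝓡 4) ∞ (grInv η Θ) (grTarget η Θ) := by
  have hy : ContMDiffOn 𝓘(ℝ, EuclideanSpace ℝ (Fin 4)) (𝓡 3) ∞ (fun w => Θ.symm (head3 w)) (grTarget η Θ) :=
    hΘ'.comp contDiff_head3.contMDiff.contMDiffOn fun w hw => hw.1
  have hY : ContMDiffOn 𝓘(ℝ, EuclideanSpace ℝ (Fin 4)) (𝓡 4) ∞
      (fun w => RegularLevel.incl B.hf (Θ.symm (head3 w))) (grTarget η Θ) :=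
    (RegularLevel.contMDiff_incl B.hf).comp_contMDiffOn hy
  have h3 : ContDiff ℝ ∞ fun w : EuclideanSpace ℝ (Fin 4) => w 3 := contDiff_euclidean.mp contDiff_id 3
  have ht : ContMDiffOn 𝓘(ℝ, EuclideanSpace ℝ (Fin 4)) 𝓘(ℝ, ℝ) ∞
      (fun w => w 3 + η (Θ.symm (head3 w))) (grTarget η Θ) :=
    h3.contMDiff.contMDiffOn.add (η.contMDiff.comp_contMDiffOn hy)
  exact B.U.contMDiff_fl.comp_contMDiffOn (hY.prodMk ht)

/-- The source of the adapted chart is open. [folklore] -/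
theorem isOpen_grSource : IsOpen (grSource Θ) :=
  (B.contMDiffOn_yL).continuousOn.isOpen_inter_preimage B.U.isOpen_band Θ.open_source

omit [T2Space X] [CompactSpace X] in
/-- The target of the adapted chart is open (for `Θ⁻¹` continuous on the target). [folklore] -/
theorem isOpen_grTarget (hΘ' : ContMDiffOn 𝓘(ℝ, EuclideanSpace ℝ (Fin 3)) (𝓡 3) ∞ Θ.symm Θ.target) :
    IsOpen (grTarget η Θ) := by
  have h1 : IsOpen (head3 ⁻¹' Θ.target : Set (EuclideanSpace ℝ (Fin 4))) :=
    Θ.open_target.preimage contDiff_head3.continuous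
  have h3 : ContDiff ℝ ∞ fun w : EuclideanSpace ℝ (Fin 4) => w 3 := contDiff_euclidean.mp contDiff_id 3
  have hc : ContinuousOn (fun w : EuclideanSpace ℝ (Fin 4) => w 3 + η (Θ.symm (head3 w))) (head3 ⁻¹' Θ.target) := by
    refine (h3.continuous.continuousOn).add ?_
    exact η.continuous.comp_continuousOn ((hΘ'.continuousOn.comp contDiff_head3.continuous.continuousOn
      fun w hw => hw))
  exact hc.isOpen_inter_preimage h1 isOpen_Ioo

variable (Θ)

/-- **The adapted chart of `X` along the graph of the bevel**, as a local homeomorphism of `X`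
into `ℝ⁴` (with `C^∞` transition to every chart, `grChart_mem_maximalAtlas`).
[cite: GayKirby2016, §4, Lemma 14] -/
def grChart (hΘ : ContMDiffOn (𝓡 3) 𝓘(ℝ, EuclideanSpace ℝ (Fin 3)) ∞ Θ Θ.source)
    (hΘ' : ContMDiffOn 𝓘(ℝ, EuclideanSpace ℝ (Fin 3)) (𝓡 3) ∞ Θ.symm Θ.target) :
    OpenPartialHomeomorph X (EuclideanSpace ℝ (Fin 4)) where
  toFun := grFun η Θ
  invFun := grInv η Θ
  source := grSource Θ
  target := grTarget η Θ
  map_source' _ hx := grFun_mem_target η hx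
  map_target' _ hw := grInv_mem_source η hw
  left_inv' _ hx := grInv_grFun η hx
  right_inv' _ hw := grFun_grInv η hw
  open_source := isOpen_grSource
  open_target := isOpen_grTarget η hΘ'
  continuousOn_toFun := (contMDiffOn_grFun η hΘ).continuousOn
  continuousOn_invFun := (contMDiffOn_grInv η hΘ').continuousOn

variable {Θ}

/-- The adapted chart, as a function (definitional). [folklore] -/
@[simp] theorem grChart_apply (hΘ : ContMDiffOn (𝓡 3) 𝓘(ℝ, EuclideanSpace ℝ (Fin 3)) ∞ Θ Θ.source)
    (hΘ' : ContMDiffOn 𝓘(ℝ, EuclideanSpace ℝ (Fin 3)) (𝓡 3) ∞ Θ.symm Θ.target) (x : X) :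
    grChart η Θ hΘ hΘ' x = grFun η Θ x := rfl

/-- **The adapted chart belongs to the maximal `C^∞` atlas of `X`.** [folklore] -/
theorem grChart_mem_maximalAtlas (hΘ : ContMDiffOn (𝓡 3) 𝓘(ℝ, EuclideanSpace ℝ (Fin 3)) ∞ Θ Θ.source)
    (hΘ' : ContMDiffOn 𝓘(ℝ, EuclideanSpace ℝ (Fin 3)) (𝓡 3) ∞ Θ.symm Θ.target) :
    grChart η Θ hΘ hΘ' ∈ IsManifold.maximalAtlas (𝓡 4) ∞ X := by
  rw [IsManifold.mem_maximalAtlas_iff_contMDiffOn]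
  exact ⟨contMDiffOn_grFun η hΘ, contMDiffOn_grInv η hΘ'⟩

end GraphChart

/-! ### The graph map is a smooth embedding -/

section Embedding

variable (η : Height B) {f' : B.Y → ℝ} {a' : ℝ} (h' : IsRegularLevel (𝓡 3) f' a')

/-- **The graph map is a `C^∞` immersion at every point**: in the half-slice chart of
`{f' ≤ a'}` at `p` (ambient chart `Θ` of the level) and the adapted chart of `X` built from the
same `Θ` and the height, it reads `u ↦ (u, 0)`. [cite: GayKirby2016, §4, Lemma 14] -/
theorem isImmersionAt_graphMap (p : RegularSublevel h') :
    Manifold.IsImmersionAtOfComplement ℝ (𝓡∂ 3) (𝓡 4) ∞ (graphMap η h') p := by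
  set Φ : HalfSliceAtlas (𝓡 3) (f' ⁻¹' Iic a') := RegularSublevel.halfSliceAtlas h' with hΦ
  set D := Φ.datum p with hD
  have hmem : graphMap η h' p ∈ (grChart η D.Θ D.contMDiffOn_toFun D.contMDiffOn_symm).source := by
    refine ⟨graphMap_mem_band η h' p, ?_⟩
    show B.yL (graphMap η h' p) ∈ D.Θ.source
    rw [yL_graphMap]
    exact Φ.mem_source p
  refine Manifold.IsImmersionAtOfComplement.mk_of_continuousAt (continuous_graphMap η h').continuousAt
    appendEquiv (D.chart p) (grChart η D.Θ D.contMDiffOn_toFun D.contMDiffOn_symm)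
    (show p ∈ (D.chart p).source from Φ.mem_source p) hmem
    (IsManifold.subset_maximalAtlas (Φ.chart_mem_atlas D p)) (grChart_mem_maximalAtlas η _ _) ?_
  intro u hu
  obtain ⟨hu0, hu1⟩ : 0 ≤ u 0 ∧ u ∈ D.Θ.target := (HalfSliceChart.mem_extend_chart_target (D := D)).1 hu
  simp only [comp_apply, OpenPartialHomeomorph.extend_coe, modelWithCornersSelf_coe, id_eq, grChart_apply]
  have hq : (((D.chart p).extend (𝓡∂ 3)).symm u).1 = D.Θ.symm u := D.coe_extend_chart_symm_of_mem hu0 hu1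
  set q : RegularSublevel h' := ((D.chart p).extend (𝓡∂ 3)).symm u with hq'
  have hq1 : RegularSublevel.incl h' q = D.Θ.symm u := hq
  have hy : B.yL (graphMap η h' q) = D.Θ.symm u := by rw [yL_graphMap, hq1]
  have hs : B.sFun (graphMap η h' q) - η (B.yL (graphMap η h' q)) = 0 := by
    rw [sFun_graphMap, hy, hq1, sub_self]
  rw [appendEquiv_apply]
  show !₂[D.Θ (B.yL (graphMap η h' q)) 0, D.Θ (B.yL (graphMap η h' q)) 1, D.Θ (B.yL (graphMap η h' q)) 2,
      B.sFun (graphMap η h' q) - η (B.yL (graphMap η h' q))] = !₂[u 0, u 1, u 2, 0]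
  rw [hs, hy, D.Θ.right_inv hu1]

/-- **The graph map is a `C^∞` embedding** of the `3`-manifold with boundary `{f' ≤ a'}` into
`X`. [cite: GayKirby2016, §4, Lemma 14] -/
theorem isSmoothEmbedding_graphMap : Manifold.IsSmoothEmbedding (𝓡∂ 3) (𝓡 4) ∞ (graphMap η h') :=
  ⟨⟨ℝ, inferInstance, inferInstance, fun p => isImmersionAt_graphMap η h' p⟩, (isClosedEmbedding_graphMap η h').isEmbedding⟩

end Embedding

namespace TriData

variable (T : B.TriData)

/-! ### The height of the bevel -/

/-- **The height of the bevel over `H₁₂ = {g ≤ b}`**: `τ y = κ χ₂(r) r` with `r = g y - b` —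
for `r ≤ 0` the unique `s` with `F₁ = s + κ χ₁(s) χ₂(r) |r| = 0` (there `χ₁(s) = 1`); over
`H₃₁ = {g ≥ b}` the height is `-τ`. [cite: GayKirby2016, §4, Lemma 14] -/
def τ (y : B.Y) : ℝ := T.D.κ * (T.D.χ₂ (B.g y - B.b) * (B.g y - B.b))

omit [T2Space X] [CompactSpace X] in
/-- `τ` is smooth. [folklore] -/
theorem contMDiff_τ : ContMDiff (𝓡 3) 𝓘(ℝ, ℝ) ∞ T.τ := by
  have hg : ContMDiff (𝓡 3) 𝓘(ℝ, ℝ) ∞ fun y : B.Y => B.g y - B.b := B.hg.contMDiff.sub contMDiff_const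
  have hχ : ContMDiff (𝓡 3) 𝓘(ℝ, ℝ) ∞ fun y : B.Y => T.D.χ₂ (B.g y - B.b) :=
    T.D.χ₂.contDiff.contMDiff.comp hg
  exact contMDiff_const.mul (hχ.mul hg)

omit [T2Space X] [CompactSpace X] in
/-- `|τ| ≤ κ · χ₂.rOut`. [folklore] -/
theorem abs_τ_le (y : B.Y) : |T.τ y| ≤ T.D.κ * T.D.χ₂.rOut := by
  have h1 : |T.D.χ₂ (B.g y - B.b) * (B.g y - B.b)| ≤ T.D.χ₂.rOut := by
    rw [abs_mul, abs_of_nonneg T.D.χ₂.nonneg]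
    exact T.D.χ₂_mul_abs_le _
  rw [τ, abs_mul, abs_of_pos T.D.κ_pos]
  exact mul_le_mul_of_nonneg_left h1 T.D.κ_pos.le

omit [T2Space X] [CompactSpace X] in
/-- `|τ| < χ₁.rIn` (so that `χ₁(±τ) = 1`). [folklore] -/
theorem abs_τ_lt_rIn (y : B.Y) : |T.τ y| < T.D.χ₁.rIn := (T.abs_τ_le y).trans_lt T.D.κ_mul_rOut₂_lt

omit [T2Space X] [CompactSpace X] in
/-- `|τ| < δ_U`. [folklore] -/
theorem abs_τ_lt_δ (y : B.Y) : |T.τ y| < B.U.δ := (T.abs_τ_lt_rIn y).trans T.D.rIn₁_lt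

omit [T2Space X] [CompactSpace X] in
/-- On the central surface (`g = b`), `τ = 0`. [folklore] -/
theorem τ_eq_zero_of_apply_eq {y : B.Y} (hy : B.g y = B.b) : T.τ y = 0 := by
  rw [τ, hy, sub_self, mul_zero, mul_zero]

/-- The height of the bevel, as a `Height`. [cite: GayKirby2016, §4, Lemma 14] -/
def τH : Height B := ⟨T.τ, T.contMDiff_τ, T.abs_τ_lt_δ⟩

omit [T2Space X] [CompactSpace X] in
/-- The height of the bevel, evaluated. [folklore] -/
@[simp] theorem τH_apply (y : B.Y) : T.τH y = T.τ y := rfl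

/-! ### `H₁₂ = X₁ ∩ X₂`: the graph of `τ` over `{g ≤ b}` -/

/-- **Along the graph over `{g ≤ b}`, `F₁ = 0`**: `s = κ χ₂(r) r` and
`θ = χ₁(s) χ₂(r) |r| = -χ₂(r) r`. [cite: GayKirby2016, §4, Lemma 14] -/
theorem F₁_graphMap₁₂ (p : RegularSublevel B.hg) : T.D.F₁ (graphMap T.τH B.hg p) = 0 := by
  set r : ℝ := B.g (RegularSublevel.incl B.hg p) - B.b with hr
  have hr0 : r ≤ 0 := by have := RegularSublevel.apply_incl_le B.hg p; rw [hr]; linarith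
  have hs : B.sFun (graphMap T.τH B.hg p) = T.D.κ * (T.D.χ₂ r * r) := sFun_graphMap T.τH B.hg p
  have hrr : B.rFun (graphMap T.τH B.hg p) = r := rFun_graphMap T.τH B.hg p
  have hχ₁ : T.D.χ₁ (B.sFun (graphMap T.τH B.hg p)) = 1 :=
    T.D.χ₁.one_of_abs_le (by rw [sFun_graphMap]; exact (T.abs_τ_lt_rIn _).le)
  show B.sFun (graphMap T.τH B.hg p) + T.D.κ * (T.D.χ₁ (B.sFun (graphMap T.τH B.hg p)) *
    (T.D.χ₂ (B.rFun (graphMap T.τH B.hg p)) * |B.rFun (graphMap T.τH B.hg p)|)) = 0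
  rw [hχ₁, hrr, hs, abs_of_nonpos hr0]
  ring

/-- The graph over `{g ≤ b}` lies in `X₁`. [cite: GayKirby2016, §4, Lemma 14] -/
theorem graphMap₁₂_mem_X₁ (p : RegularSublevel B.hg) : graphMap T.τH B.hg p ∈ T.X₁ :=
  T.D.mem_sector_iff.2 (T.F₁_graphMap₁₂ p).le

/-- The graph over `{g ≤ b}` lies in `X₂` (the band lies below `c - 2ε`). [cite: GayKirby2016, §4, Lemma 14] -/
theorem graphMap₁₂_mem_X₂ (hc2 : B.a + B.U.δ + 2 * T.ε ≤ T.c) (p : RegularSublevel B.hg) :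
    graphMap T.τH B.hg p ∈ T.X₂ := by
  have hr : B.rFun (graphMap T.τH B.hg p) ≤ 0 := by
    rw [rFun_graphMap]; have := RegularSublevel.apply_incl_le B.hg p; linarith
  rcases hr.lt_or_eq with hlt | heq
  · exact (T.mem_X₂_iff_of_mem_posSet hc2 ⟨graphMap_mem_band T.τH B.hg p,
      by show 0 < (-1) * B.rFun (graphMap T.τH B.hg p); linarith⟩).2 (T.F₁_graphMap₁₂ p).ge
  · apply T.surface_subset_X₂
    rw [B.mem_surface_iff]
    refine ⟨?_, heq⟩
    rw [sFun_graphMap]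
    exact T.τ_eq_zero_of_apply_eq (by have := rFun_graphMap T.τH B.hg p; linarith)

/-- **`X₁ ∩ X₂` is the graph of the bevel over `{g ≤ b}`.** [cite: GayKirby2016, §4, Lemma 14] -/
theorem range_graphMap₁₂ (hc2 : B.a + B.U.δ + 2 * T.ε ≤ T.c) : range (graphMap T.τH B.hg) = T.X₁ ∩ T.X₂ := by
  refine Subset.antisymm ?_ fun x hx => ?_
  · rintro _ ⟨p, rfl⟩
    exact ⟨T.graphMap₁₂_mem_X₁ p, T.graphMap₁₂_mem_X₂ hc2 p⟩
  · have h0 : T.D.F₁ x = 0 := T.F₁_eq_zero_of_mem_X₁_X₂ hx.1 hx.2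
    have hxU : x ∈ B.U.band := T.D.mem_band_of_F₁_eq_zero h0
    have hr : B.rFun x ≤ 0 := by
      by_cases hxs : x ∈ B.surface
      · exact ((B.mem_surface_iff x).1 hxs).2.le
      · exact (T.rFun_neg_of_mem_X₂ hc2 hx.2 h0 hxs).le
    have hχ₁ : T.D.χ₁ (B.sFun x) = 1 := T.D.χ₁.one_of_abs_le (T.D.abs_sFun_lt_rIn_of_F₁_eq_zero h0).le
    refine mem_range_graphMap_of_eq T.τH B.hg hxU (by have : B.rFun x = B.g (B.yL x) - B.b := rfl; linarith) ?_
    have h0' : B.sFun x + T.D.κ * (T.D.χ₁ (B.sFun x) * (T.D.χ₂ (B.rFun x) * |B.rFun x|)) = 0 := h0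
    rw [hχ₁, one_mul, abs_of_nonpos hr] at h0'
    show B.sFun x = T.D.κ * (T.D.χ₂ (B.g (B.yL x) - B.b) * (B.g (B.yL x) - B.b))
    have : B.rFun x = B.g (B.yL x) - B.b := rfl
    rw [← this]
    linarith

/-- **The boundary `{g = b}` goes onto the central surface `F`.** [cite: GayKirby2016, Def. 1 and §4, Lemma 14] -/
theorem image_boundary_graphMap₁₂ :
    graphMap T.τH B.hg '' (𝓡∂ 3).boundary (RegularSublevel B.hg) = B.surface := by
  ext x
  constructor
  · rintro ⟨p, hp, rfl⟩
    have hgp : B.g (RegularSublevel.incl B.hg p) = B.b := (RegularSublevel.mem_boundary_iff B.hg p).1 hp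
    refine ⟨⟨RegularSublevel.incl B.hg p, hgp⟩, ?_⟩
    show RegularLevel.incl B.hf (RegularLevel.incl B.hg ⟨RegularSublevel.incl B.hg p, hgp⟩) = graphMap T.τH B.hg p
    rw [graphMap_eq_of_apply_eq T.τH B.hg (T.τ_eq_zero_of_apply_eq hgp)]
  · rintro ⟨z, rfl⟩
    have hgz : B.g (RegularLevel.incl B.hg z) = B.b := RegularLevel.apply_incl B.hg z
    refine ⟨RegularSublevel.mk B.hg (RegularLevel.incl B.hg z) hgz.le,
      (RegularSublevel.mem_boundary_iff B.hg _).2 hgz, ?_⟩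
    rw [graphMap_eq_of_apply_eq T.τH B.hg
      (show T.τH (RegularSublevel.incl B.hg (RegularSublevel.mk B.hg (RegularLevel.incl B.hg z) hgz.le)) = 0 from
        T.τ_eq_zero_of_apply_eq hgz)]
    rfl

/-! ### `H₃₁ = X₃ ∩ X₁`: the graph of `-τ` over `{g ≥ b}` -/

/-- **Along the graph of `-τ` over `{g ≥ b}`, `F₁ = 0`**: `s = -κ χ₂(r) r` and
`θ = χ₁(s) χ₂(r) |r| = χ₂(r) r`. [cite: GayKirby2016, §4, Lemma 14] -/
theorem F₁_graphMap₃₁ (p : RegularSuperlevel B.hg) : T.D.F₁ (graphMap T.τH.neg B.hg.const_sub p) = 0 := by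
  set r : ℝ := B.g (RegularSublevel.incl B.hg.const_sub p) - B.b with hr
  have hr0 : 0 ≤ r := by
    have := RegularSublevel.apply_incl_le B.hg.const_sub p
    have h : B.b - B.g (RegularSublevel.incl B.hg.const_sub p) ≤ 0 := this
    rw [hr]; linarith
  have hs : B.sFun (graphMap T.τH.neg B.hg.const_sub p) = -(T.D.κ * (T.D.χ₂ r * r)) :=
    sFun_graphMap T.τH.neg B.hg.const_sub p
  have hrr : B.rFun (graphMap T.τH.neg B.hg.const_sub p) = r := rFun_graphMap T.τH.neg B.hg.const_sub p
  have hχ₁ : T.D.χ₁ (B.sFun (graphMap T.τH.neg B.hg.const_sub p)) = 1 :=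
    T.D.χ₁.one_of_abs_le (by rw [sFun_graphMap, Height.neg_apply, abs_neg]; exact (T.abs_τ_lt_rIn _).le)
  show B.sFun (graphMap T.τH.neg B.hg.const_sub p) + T.D.κ * (T.D.χ₁ (B.sFun (graphMap T.τH.neg B.hg.const_sub p)) *
    (T.D.χ₂ (B.rFun (graphMap T.τH.neg B.hg.const_sub p)) * |B.rFun (graphMap T.τH.neg B.hg.const_sub p)|)) = 0
  rw [hχ₁, hrr, hs, abs_of_nonneg hr0]
  ring

/-- The graph over `{g ≥ b}` lies in `X₁`. [cite: GayKirby2016, §4, Lemma 14] -/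
theorem graphMap₃₁_mem_X₁ (p : RegularSuperlevel B.hg) : graphMap T.τH.neg B.hg.const_sub p ∈ T.X₁ :=
  T.D.mem_sector_iff.2 (T.F₁_graphMap₃₁ p).le

/-- The graph over `{g ≥ b}` lies in `X₃`. [cite: GayKirby2016, §4, Lemma 14] -/
theorem graphMap₃₁_mem_X₃ (hc2 : B.a + B.U.δ + 2 * T.ε ≤ T.c) (p : RegularSuperlevel B.hg) :
    graphMap T.τH.neg B.hg.const_sub p ∈ T.X₃ := by
  have hr : 0 ≤ B.rFun (graphMap T.τH.neg B.hg.const_sub p) := by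
    rw [rFun_graphMap]
    have := RegularSublevel.apply_incl_le B.hg.const_sub p
    have h : B.b - B.g (RegularSublevel.incl B.hg.const_sub p) ≤ 0 := this
    linarith
  rcases hr.lt_or_eq with hlt | heq
  · exact (T.mem_X₃_iff_of_mem_posSet hc2 ⟨graphMap_mem_band T.τH.neg B.hg.const_sub p,
      by show 0 < 1 * B.rFun (graphMap T.τH.neg B.hg.const_sub p); linarith⟩).2 (T.F₁_graphMap₃₁ p).ge
  · apply T.surface_subset_X₃
    rw [B.mem_surface_iff]
    refine ⟨?_, heq.symm⟩
    rw [sFun_graphMap, Height.neg_apply, neg_eq_zero]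
    exact T.τ_eq_zero_of_apply_eq (by have := rFun_graphMap T.τH.neg B.hg.const_sub p; linarith)

/-- **`X₃ ∩ X₁` is the graph of `-τ` over `{g ≥ b}`.** [cite: GayKirby2016, §4, Lemma 14] -/
theorem range_graphMap₃₁ (hc2 : B.a + B.U.δ + 2 * T.ε ≤ T.c) :
    range (graphMap T.τH.neg B.hg.const_sub) = T.X₃ ∩ T.X₁ := by
  refine Subset.antisymm ?_ fun x hx => ?_
  · rintro _ ⟨p, rfl⟩
    exact ⟨T.graphMap₃₁_mem_X₃ hc2 p, T.graphMap₃₁_mem_X₁ p⟩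
  · have h0 : T.D.F₁ x = 0 := T.F₁_eq_zero_of_mem_X₁_X₃ hx.2 hx.1
    have hxU : x ∈ B.U.band := T.D.mem_band_of_F₁_eq_zero h0
    have hr : 0 ≤ B.rFun x := by
      by_cases hxs : x ∈ B.surface
      · exact ((B.mem_surface_iff x).1 hxs).2.ge
      · exact (T.rFun_pos_of_mem_X₃ hc2 hx.1 h0 hxs).le
    have hχ₁ : T.D.χ₁ (B.sFun x) = 1 := T.D.χ₁.one_of_abs_le (T.D.abs_sFun_lt_rIn_of_F₁_eq_zero h0).le
    refine mem_range_graphMap_of_eq T.τH.neg B.hg.const_sub hxU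
      (by show B.b - B.g (B.yL x) ≤ 0; have : B.rFun x = B.g (B.yL x) - B.b := rfl; linarith) ?_
    have h0' : B.sFun x + T.D.κ * (T.D.χ₁ (B.sFun x) * (T.D.χ₂ (B.rFun x) * |B.rFun x|)) = 0 := h0
    rw [hχ₁, one_mul, abs_of_nonneg hr] at h0'
    show B.sFun x = -(T.D.κ * (T.D.χ₂ (B.g (B.yL x) - B.b) * (B.g (B.yL x) - B.b)))
    have : B.rFun x = B.g (B.yL x) - B.b := rfl
    rw [← this]
    linarith

/-- **The boundary `{g = b}` of `{g ≥ b}` goes onto the central surface `F`.** [cite: GayKirby2016, Def. 1 and §4, Lemma 14] -/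
theorem image_boundary_graphMap₃₁ :
    graphMap T.τH.neg B.hg.const_sub '' (𝓡∂ 3).boundary (RegularSuperlevel B.hg) = B.surface := by
  ext x
  constructor
  · rintro ⟨p, hp, rfl⟩
    have hgp' : B.b - B.g (RegularSublevel.incl B.hg.const_sub p) = 0 :=
      (RegularSublevel.mem_boundary_iff B.hg.const_sub p).1 hp
    have hgp : B.g (RegularSublevel.incl B.hg.const_sub p) = B.b := by linarith
    refine ⟨⟨RegularSublevel.incl B.hg.const_sub p, hgp⟩, ?_⟩
    have hτ0 : T.τH.neg (RegularSublevel.incl B.hg.const_sub p) = 0 := by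
      show -T.τ (RegularSublevel.incl B.hg.const_sub p) = 0
      rw [neg_eq_zero]; exact T.τ_eq_zero_of_apply_eq hgp
    show RegularLevel.incl B.hf (RegularLevel.incl B.hg ⟨RegularSublevel.incl B.hg.const_sub p, hgp⟩) = _
    rw [graphMap_eq_of_apply_eq T.τH.neg B.hg.const_sub hτ0]
  · rintro ⟨z, rfl⟩
    have hgz : B.g (RegularLevel.incl B.hg z) = B.b := RegularLevel.apply_incl B.hg z
    have hle : (fun y => B.b - B.g y) (RegularLevel.incl B.hg z) ≤ 0 := by
      show B.b - B.g (RegularLevel.incl B.hg z) ≤ 0; linarith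
    have heq0 : (fun y => B.b - B.g y) (RegularLevel.incl B.hg z) = 0 := by
      show B.b - B.g (RegularLevel.incl B.hg z) = 0; linarith
    refine ⟨RegularSublevel.mk B.hg.const_sub (RegularLevel.incl B.hg z) hle,
      (RegularSublevel.mem_boundary_iff B.hg.const_sub _).2 heq0, ?_⟩
    have hτ0 : T.τH.neg (RegularSublevel.incl B.hg.const_sub
        (RegularSublevel.mk B.hg.const_sub (RegularLevel.incl B.hg z) hle)) = 0 := by
      show -T.τ (RegularLevel.incl B.hg z) = 0
      rw [neg_eq_zero]; exact T.τ_eq_zero_of_apply_eq hgz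
    rw [graphMap_eq_of_apply_eq T.τH.neg B.hg.const_sub hτ0]
    rfl

/-! ### The triple intersection and clause (iii) for `H₁₂`, `H₃₁` -/

/-- **The central surface is the triple intersection**: `X₁ ∩ X₂ ∩ X₃ = F`. [cite: GayKirby2016, Def. 1] -/
theorem iInter_eq_surface (hc2 : B.a + B.U.δ + 2 * T.ε ≤ T.c) : (⋂ i, ![T.X₁, T.X₂, T.X₃] i) = B.surface := by
  ext x
  simp only [mem_iInter]
  constructor
  · intro h
    have h1 : x ∈ T.X₁ := h 0
    have h2 : x ∈ T.X₂ := h 1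
    have h3 : x ∈ T.X₃ := h 2
    by_contra hxs
    have h0 : T.D.F₁ x = 0 := T.F₁_eq_zero_of_mem_X₁_X₂ h1 h2
    have hneg := T.rFun_neg_of_mem_X₂ hc2 h2 h0 hxs
    have hpos := T.rFun_pos_of_mem_X₃ hc2 h3 h0 hxs
    linarith
  · intro hx i
    fin_cases i
    · exact T.D.surface_subset_sector hx
    · exact T.surface_subset_X₂ hx
    · exact T.surface_subset_X₃ hx

/-- **`X₁ ∩ X₂` is a handlebody `H₁₂` as in clause (iii) of a trisection**, given the Morse
data of the Heegaard function `g` below `b` (one critical point of index `0`, `gen` of index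
`1`, none of higher index) and that `g` has at most one local minimum. [cite: GayKirby2016, Def. 1 and §4, Lemma 14] -/
theorem exists_H₁₂ (hc2 : B.a + B.U.δ + 2 * T.ε ≤ T.c) (hgM : IsMorse (𝓡 3) B.g) {gen : ℕ}
    (hcount : ∀ i, (criticalSetOfIndex (𝓡 3) B.g i ∩ B.g ⁻¹' Iic B.b).ncard = handleCount 1 gen i)
    (h0 : (criticalSetOfIndex (𝓡 3) B.g 0).Subsingleton) :
    ∃ (H : Type u) (_ : TopologicalSpace H) (_ : ChartedSpace (EuclideanHalfSpace 3) H) (h : H → X),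
      IsManifold (𝓡∂ 3) ∞ H ∧ CompactSpace H ∧ ConnectedSpace H ∧
        HasHandleDecomposition 2 H (handleCount 1 gen) ∧
        Manifold.IsSmoothEmbedding (𝓡∂ 3) (𝓡 4) ∞ h ∧ range h = T.X₁ ∩ T.X₂ ∧
        h '' (𝓡∂ 3).boundary H = B.surface := by
  have hconn : ConnectedSpace (RegularSublevel B.hg) := by
    obtain ⟨z⟩ := B.nonempty_F
    exact RegularSublevel.connectedSpace B.hg h0 ⟨RegularLevel.incl B.hg z, (RegularLevel.apply_incl B.hg z).le⟩
  have hhd : HasHandleDecomposition 2 (RegularSublevel B.hg) (handleCount 1 gen) := by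
    have h := RegularSublevel.hasHandleDecomposition hgM B.hg
    have heq : (fun i => (criticalSetOfIndex (𝓡 3) B.g i ∩ B.g ⁻¹' Iic B.b).ncard) = handleCount 1 gen :=
      funext hcount
    rw [heq] at h
    exact h
  exact ⟨RegularSublevel B.hg, inferInstance, inferInstance, graphMap T.τH B.hg, inferInstance, inferInstance, hconn, hhd,
    isSmoothEmbedding_graphMap T.τH B.hg, T.range_graphMap₁₂ hc2, T.image_boundary_graphMap₁₂⟩

/-- **`X₃ ∩ X₁` is a handlebody `H₃₁` as in clause (iii) of a trisection**, given the Morse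
data of `b - g` below `0`, i.e. of the Heegaard function `g` above `b` (one critical point of
index `3`, `gen` of index `2`, none of lower index above `b`), and that `g` has at most one local
maximum. [cite: GayKirby2016, Def. 1 and §4, Lemma 14] -/
theorem exists_H₃₁ (hc2 : B.a + B.U.δ + 2 * T.ε ≤ T.c) (hgM : IsMorse (𝓡 3) B.g) {gen : ℕ}
    (hcount : ∀ i, (criticalSetOfIndex (𝓡 3) (fun y => B.b - B.g y) i ∩
      (fun y => B.b - B.g y) ⁻¹' Iic 0).ncard = handleCount 1 gen i)
    (htop : (criticalSetOfIndex (𝓡 3) B.g 3).Subsingleton) :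
    ∃ (H : Type u) (_ : TopologicalSpace H) (_ : ChartedSpace (EuclideanHalfSpace 3) H) (h : H → X),
      IsManifold (𝓡∂ 3) ∞ H ∧ CompactSpace H ∧ ConnectedSpace H ∧
        HasHandleDecomposition 2 H (handleCount 1 gen) ∧
        Manifold.IsSmoothEmbedding (𝓡∂ 3) (𝓡 4) ∞ h ∧ range h = T.X₃ ∩ T.X₁ ∧
        h '' (𝓡∂ 3).boundary H = B.surface := by
  have hconn : ConnectedSpace (RegularSuperlevel B.hg) := by
    obtain ⟨z⟩ := B.nonempty_F
    exact RegularSublevel.connectedSpace_superlevel hgM B.hg htop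
      ⟨RegularLevel.incl B.hg z, (RegularLevel.apply_incl B.hg z).ge⟩
  have hhd : HasHandleDecomposition 2 (RegularSuperlevel B.hg) (handleCount 1 gen) := by
    have h := RegularSublevel.hasHandleDecomposition (hgM.const_sub B.b) B.hg.const_sub
    have heq : (fun i => (criticalSetOfIndex (𝓡 3) (fun y => B.b - B.g y) i ∩
        (fun y => B.b - B.g y) ⁻¹' Iic 0).ncard) = handleCount 1 gen := funext hcount
    rw [heq] at h
    exact h
  exact ⟨RegularSuperlevel B.hg, inferInstance, inferInstance, graphMap T.τH.neg B.hg.const_sub, inferInstance,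
    inferInstance, hconn, hhd, isSmoothEmbedding_graphMap T.τH.neg B.hg.const_sub, T.range_graphMap₃₁ hc2,
    T.image_boundary_graphMap₃₁⟩

end TriData

end BiCollar

end Literature.Topology.FourManifolds

end
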